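import Mathlib.Algebra.MvPolynomial.Expand
import Mathlib.Algebra.MvPolynomial.PDeriv
import Mathlib.Algebra.MvPolynomial.Equiv
import Mathlib.Algebra.MvPolynomial.CommRing
import Mathlib.RingTheory.AdjoinRoot
import Mathlib.RingTheory.Derivation.Basic
import Mathlib.RingTheory.IntegralClosure.IntegrallyClosed
import Mathlib.RingTheory.Localization.FractionRing
import Mathlib.RingTheory.Polynomial.UniqueFactorization
import Mathlib.Algebra.CharP.Lemmas
import Mathlib.Algebra.CharP.Basic
import HarnessLib

/-!
# [OURS · L1 W8.2] The `A_{p−1}` ring `F[u,y,z]/(u^p − yz)` in characteristic `p` is a NORMAL, NON-REGULAR domain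

Cell `res-hironaka` (run/shared/lean/pub/res-hironaka/), LADDER-RESOLUTION rung L (RESCUE), slot W8.2 of
plan/RESCUE-SEED.md («PRIME-FIELD / UNIVERSALITY TRANSFER instead of descent»), door 2 = route
`UniformComplexity`, host item `PrimeModelTransfer` (stmt-ResolutionOfSingularities-8933); prover
res-L1-s82-pv-2 (gen 4). THESES-FREE algebra module (imports Mathlib and `HarnessLib` only). Consumed by the
siblings Theorems/UniformComplexityCampaignW82TwistNormalRing.lean (hypersurface presentation: normal, not
regular) and …TwistNormal.lean (the rung «NORMALISING THE FROBENIUS TWISTS NEVER SUFFICES, from dimension 2»).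

[OURS · L1 W8.2] support lemmas; replace the role of no printed item; NOT statements of H. Hironaka's manuscript.
This is the algebra behind near-miss (s2) of Cruxes/PrimeFieldToPerfect/Disproof.lean
(`twistedSurface_normal_not_regular`, there stated for `u^p + y² + z²`, `p` odd, and left `sorry` for want of a
normality argument) = strategist census N3, in the split form `u^p − yz` which works for EVERY prime `p`:

* §1 `isIntegrallyClosed_of_derivation` — NORMALITY VIA CONSTANTS OF A DERIVATION: if `φ : R ↪ B` is an
  injective ring map of domains into an integrally closed `B`, and a derivation `D` of `B` kills `φ(R)` with all
  its constants inside `φ(R)`, then `R` is integrally closed (`r/s ↦ b ∈ B` with `b·φ(s) = φ(r)`, so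
  `φ(s)·Db = 0`, `b` is a constant, `b = φ(r')`, `r = r's`).
* §2–§4 the `A_{p−1}` ring `A = F[y,z][u]/(u^p − yz)` (`ApRing`, an `AdjoinRoot` over `F[y,z] =
  MvPolynomial (Fin 2) F`) and its embedding `toPlane : A → F[a,b]`, `u ↦ ab`, `y ↦ a^p`, `z ↦ b^p` (Mathlib's
  `MvPolynomial.expand p` on coefficients): the derivation `E = a∂_a − b∂_b` (`euler`; `coeff_euler`:
  `E` multiplies the monomial `a^{s₀}b^{s₁}` by `s₀ − s₁`) kills `toPlane(A)` (`euler_toPlane`) and its constants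
  are sums of monomials with `s₀ ≡ s₁ (mod p)`, which lie in `toPlane(A)` (`mem_range_toPlane_of_euler_eq_zero`);
  `toPlane` is INJECTIVE (`toPlane_injective`: a class has a representative of `u`-degree `< p`, and the
  coefficient of `a^{pm₀+i}b^{pm₁+i}` in its image is the coefficient of `y^{m₀}z^{m₁}` in `cᵢ` —
  `coeff_toPlane_mk`, the `a`-exponent mod `p` separates the summands).
* (sibling file Theorems/UniformComplexityCampaignW82TwistNormalRing.lean, §5) the hypersurface presentation
  `F[u,y,z]/(u^p − yz)`: domain, NORMAL (`isIntegrallyClosed_apQuot`), NOT regular at `(u,y,z)`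
  (`not_isRegularLocalRing_origin`, Jacobian criterion) — it is its own normalisation and is singular.

HONEST FRAMING. OURS support; the mathematics is classical (the `A_{p−1}` rational double point is the ring of
invariants `F[a^p, ab, b^p] ⊂ F[a,b]`, normal as the ring of constants of a derivation of a normal domain);
nothing here is a statement of H. Hironaka's manuscript [Hironaka2017], nothing attributed to its author. No
`sorry`, no new axioms. AI work, weaker than expert review.

## References (locators only)
* N. Shepherd-Barron, arXiv:1711.10439, Remark 2(1) («for families that map into the discriminant locus it
  might be necessary to take an inseparable cover; for example `xy + z² + t = 0`, `A_1` in characteristic 2»).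
* Zs. Patakfalvi, J. Waldron, *Singularities of general fibers and the LMMP*, arXiv:1708.04268, §2.4 (the
  examples `x^p − t + …`). [PatakfalviWaldron]
* H. Matsumura, *Commutative Ring Theory* (1986), Thm. 14.2 / Jacobian criterion (Hartshorne I 5.1).
  [Matsumura1987] [Hartshorne1977]
-/

noncomputable section

set_option linter.dupNamespace false -- mandated namespace of this single-conjunct summit

open Polynomial IsLocalRing

namespace Summit.ResolutionOfSingularities.ResolutionOfSingularities.Theorems.CampaignW82.TwistNormal

/-! ## §1 Normality through an embedding as the constants of a derivation -/

/-- **Normality via constants of a derivation.** Let `φ : R → B` be an injective ring map of domains,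
`B` integrally closed, and `D` a derivation of `B` killing `φ(R)` such that every constant of `D` lies in
`φ(R)`. Then `R` is integrally closed: an element `r/s` of `Frac R` integral over `R` becomes `b ∈ B`
with `b·φ(s) = φ(r)`, so `φ(s)·D b = 0`, `D b = 0`, `b = φ(r')`, and `r = r' s`. [folklore] -/
theorem isIntegrallyClosed_of_derivation {R B A : Type*} [CommRing R] [IsDomain R] [CommRing B] [IsDomain B]
    [IsIntegrallyClosed B] [CommRing A] [Algebra A B] (φ : R →+* B) (hφ : Function.Injective φ)
    (D : Derivation A B B) (hD : ∀ r, D (φ r) = 0) (hker : ∀ b, D b = 0 → b ∈ φ.range) :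
    IsIntegrallyClosed R := by
  let K := FractionRing R
  let L := FractionRing B
  have hφ0 : ∀ {s : R}, s ≠ 0 → φ s ≠ 0 := fun hs h0 => hs (hφ (by rw [h0, map_zero]))
  have hle : nonZeroDivisors R ≤ (nonZeroDivisors B).comap φ := fun s hs =>
    mem_nonZeroDivisors_of_ne_zero (hφ0 (nonZeroDivisors.ne_zero hs))
  let ψ : K →+* L := IsLocalization.map L φ hle
  refine (isIntegrallyClosed_iff K).mpr fun {x} hx => ?_
  obtain ⟨⟨r, s⟩, rfl⟩ := IsLocalization.mk'_surjective (nonZeroDivisors R) x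
  -- `ψ x` is integral over `B`
  have hint : IsIntegral B (ψ (IsLocalization.mk' K r s)) := by
    obtain ⟨P, hPm, hP⟩ := hx
    refine ⟨P.map φ, hPm.map φ, ?_⟩
    have hcomp : (algebraMap B L).comp φ = ψ.comp (algebraMap R K) := by
      ext a
      simp [ψ]
    rw [Polynomial.eval₂_map, hcomp, ← Polynomial.hom_eval₂, hP, map_zero]
  obtain ⟨b, hb⟩ := (IsIntegrallyClosed.isIntegral_iff (R := B) (K := L)).mp hint
  rw [IsLocalization.map_mk'] at hb
  have hbs : b * φ s = φ r := by
    have h := (IsLocalization.eq_mk'_iff_mul_eq).mp hb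
    simp only at h
    rw [← map_mul] at h
    exact IsFractionRing.injective B L h
  have hDb : D b = 0 := by
    have h1 : D (b * φ s) = 0 := by rw [hbs]; exact hD r
    rw [D.leibniz, hD s, smul_zero, zero_add, smul_eq_mul] at h1
    exact (mul_eq_zero.mp h1).resolve_left (hφ0 (nonZeroDivisors.ne_zero s.2))
  obtain ⟨r', hr'⟩ := hker b hDb
  refine ⟨r', ?_⟩
  rw [IsLocalization.eq_mk'_iff_mul_eq, ← map_mul]
  congr 1
  apply hφ
  rw [map_mul, hr', hbs]

/-! ## §2 The ring `A = F[y,z][u]/(u^p − yz)` and its embedding `u ↦ ab`, `y ↦ a^p`, `z ↦ b^p` into `F[a,b]` -/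

section ApRing

variable (F : Type) [Field F] (p : ℕ)

/-- `g = U^p − yz ∈ F[y,z][U]` (`y = X₀`, `z = X₁` of `F[y,z] = MvPolynomial (Fin 2) F`). [folklore] -/
def gPolyAp : (MvPolynomial (Fin 2) F)[X] := X ^ p - C (MvPolynomial.X 0 * MvPolynomial.X 1)

/-- `g` is monic (`p ≠ 0`). [folklore] -/
theorem monic_gPolyAp (hp0 : p ≠ 0) : (gPolyAp F p).Monic := monic_X_pow_sub_C _ hp0

/-- `natDegree g = p`. [folklore] -/
theorem natDegree_gPolyAp : (gPolyAp F p).natDegree = p := by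
  rw [gPolyAp, natDegree_X_pow_sub_C]

/-- The `A_{p−1}` ring `A = F[y,z][u]/(u^p − yz)`. [folklore] -/
abbrev ApRing : Type := AdjoinRoot (gPolyAp F p)

/-- **The embedding `A → F[a,b]`, `u ↦ ab`, `y ↦ a^p`, `z ↦ b^p`** (on coefficients it is Mathlib's
`MvPolynomial.expand p`; the target `F[a,b]` is the same type `MvPolynomial (Fin 2) F`). [folklore] -/
def toPlane : ApRing F p →+* MvPolynomial (Fin 2) F :=
  AdjoinRoot.lift (MvPolynomial.expand p).toRingHom (MvPolynomial.X 0 * MvPolynomial.X 1) (by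
    rw [gPolyAp, eval₂_sub, eval₂_X_pow, eval₂_C]
    simp [MvPolynomial.expand_X, mul_pow])

/-- `toPlane` on a representative: `Σ cᵢ uⁱ ↦ Σ cᵢ(a^p, b^p) (ab)ⁱ`. [folklore] -/
theorem toPlane_mk (H : (MvPolynomial (Fin 2) F)[X]) :
    toPlane F p (AdjoinRoot.mk _ H) =
      H.eval₂ (MvPolynomial.expand p).toRingHom (MvPolynomial.X 0 * MvPolynomial.X 1) :=
  AdjoinRoot.lift_mk _ H

/-! ## §3 The derivation `E = a∂_a − b∂_b` of `F[a,b]`: it kills `A`, and its constants lie in `A` -/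

/-- `E = a ∂/∂a − b ∂/∂b`. [folklore] -/
def euler : Derivation F (MvPolynomial (Fin 2) F) (MvPolynomial (Fin 2) F) :=
  (MvPolynomial.X 0 : MvPolynomial (Fin 2) F) • MvPolynomial.pderiv 0 -
    (MvPolynomial.X 1 : MvPolynomial (Fin 2) F) • MvPolynomial.pderiv 1

/-- `X_i · ∂/∂X_i (monomial s c) = s_i · monomial s c`. [folklore] -/
theorem X_mul_pderiv_monomial (i : Fin 2) (s : Fin 2 →₀ ℕ) (c : F) :
    MvPolynomial.X i * MvPolynomial.pderiv i (MvPolynomial.monomial s c) =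
      (s i : F) • MvPolynomial.monomial s c := by
  rw [MvPolynomial.pderiv_monomial, MvPolynomial.smul_monomial]
  by_cases hs : s i = 0
  · rw [hs, Nat.cast_zero, mul_zero, zero_smul, MvPolynomial.monomial_zero, MvPolynomial.monomial_zero,
      mul_zero]
  · rw [MvPolynomial.X, MvPolynomial.monomial_mul, one_mul, smul_eq_mul, mul_comm c,
      add_tsub_cancel_of_le (Finsupp.single_le_iff.mpr (Nat.one_le_iff_ne_zero.mpr hs))]

/-- `E (monomial s c) = (s₀ − s₁) · monomial s c`. [folklore] -/
theorem euler_monomial (s : Fin 2 →₀ ℕ) (c : F) :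
    euler F (MvPolynomial.monomial s c) = ((s 0 : F) - (s 1 : F)) • MvPolynomial.monomial s c := by
  simp only [euler, Derivation.sub_apply, Derivation.smul_apply, smul_eq_mul, X_mul_pderiv_monomial,
    sub_smul]

/-- `coeff_s (E g) = (s₀ − s₁) · coeff_s g`. [folklore] -/
theorem coeff_euler (g : MvPolynomial (Fin 2) F) (s : Fin 2 →₀ ℕ) :
    MvPolynomial.coeff s (euler F g) = ((s 0 : F) - (s 1 : F)) * MvPolynomial.coeff s g := by
  classical
  conv_lhs => rw [g.as_sum, map_sum]
  simp only [euler_monomial, MvPolynomial.coeff_sum, MvPolynomial.coeff_smul,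
    MvPolynomial.coeff_monomial, smul_eq_mul, mul_ite, mul_zero]
  rw [Finset.sum_ite_eq']
  split_ifs with h
  · rfl
  · rw [MvPolynomial.notMem_support_iff.mp h, mul_zero]

/-- `E` kills `cᵖ`-shaped elements: `E (expand p c) = 0`. [folklore] -/
theorem euler_expand [CharP F p] (c : MvPolynomial (Fin 2) F) : euler F (MvPolynomial.expand p c) = 0 := by
  ext s
  rw [coeff_euler, MvPolynomial.coeff_zero]
  by_cases h0 : p ∣ s 0
  · by_cases h1 : p ∣ s 1
    · obtain ⟨a, ha⟩ := h0
      obtain ⟨b, hb⟩ := h1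
      rw [ha, hb]
      simp
    · rw [MvPolynomial.coeff_expand_of_not_dvd c h1, mul_zero]
  · rw [MvPolynomial.coeff_expand_of_not_dvd c h0, mul_zero]

/-- `E (ab) = 0`. [folklore] -/
theorem euler_X_mul_X : euler F (MvPolynomial.X 0 * MvPolynomial.X 1 : MvPolynomial (Fin 2) F) = 0 := by
  have h : (MvPolynomial.X 0 * MvPolynomial.X 1 : MvPolynomial (Fin 2) F) =
      MvPolynomial.monomial (Finsupp.single 0 1 + Finsupp.single 1 1) 1 := by
    rw [MvPolynomial.X, MvPolynomial.X, MvPolynomial.monomial_mul, one_mul]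
  rw [h, euler_monomial]
  simp

/-- **`E` kills the image of `A`.** [folklore] -/
theorem euler_toPlane [CharP F p] (w : ApRing F p) : euler F (toPlane F p w) = 0 := by
  induction w using AdjoinRoot.induction_on with
  | ih H =>
    rw [toPlane_mk, Polynomial.eval₂_eq_sum_range, map_sum]
    refine Finset.sum_eq_zero fun i _ => ?_
    rw [Derivation.leibniz, Derivation.leibniz_pow, euler_X_mul_X]
    simp only [smul_zero, zero_add, AlgHom.toRingHom_eq_coe, RingHom.coe_coe, euler_expand]

/-- **A monomial `a^{s₀} b^{s₁}` with `s₀ ≡ s₁ (mod p)` lies in the image of `A`**: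
`a^{s₀}b^{s₁} = (ab)^{min} · (a^p or b^p)^k`. [folklore] -/
theorem monomial_mem_range_toPlane {s : Fin 2 →₀ ℕ} (hs : s 0 ≡ s 1 [MOD p]) (c : F) :
    MvPolynomial.monomial s c ∈ (toPlane F p).range := by
  have hmon : MvPolynomial.monomial s c =
      MvPolynomial.C c * MvPolynomial.X 0 ^ (s 0) * MvPolynomial.X 1 ^ (s 1) := by
    rw [MvPolynomial.monomial_eq, Finsupp.prod_fintype _ _ (fun i => by simp), Fin.prod_univ_two, mul_assoc]
  rcases le_total (s 0) (s 1) with h | h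
  · -- `s 1 = s 0 + p k`
    obtain ⟨k, hk⟩ : p ∣ s 1 - s 0 := (Nat.modEq_iff_dvd' h).mp hs
    refine ⟨AdjoinRoot.mk _ (C (MvPolynomial.C c * MvPolynomial.X 1 ^ k) * X ^ (s 0)), ?_⟩
    rw [toPlane_mk, eval₂_mul, eval₂_C, eval₂_X_pow, AlgHom.toRingHom_eq_coe, RingHom.coe_coe, map_mul,
      map_pow, MvPolynomial.expand_C, MvPolynomial.expand_X, hmon,
      show s 1 = s 0 + p * k by omega]
    ring
  · obtain ⟨k, hk⟩ : p ∣ s 0 - s 1 := (Nat.modEq_iff_dvd' h).mp hs.symm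
    refine ⟨AdjoinRoot.mk _ (C (MvPolynomial.C c * MvPolynomial.X 0 ^ k) * X ^ (s 1)), ?_⟩
    rw [toPlane_mk, eval₂_mul, eval₂_C, eval₂_X_pow, AlgHom.toRingHom_eq_coe, RingHom.coe_coe, map_mul,
      map_pow, MvPolynomial.expand_C, MvPolynomial.expand_X, hmon,
      show s 0 = s 1 + p * k by omega]
    ring

/-- **The constants of `E` lie in the image of `A`**: if `E b = 0` then every monomial `a^{s₀}b^{s₁}`
of `b` has `s₀ ≡ s₁ (mod p)` (`coeff_euler`, characteristic `p`). [folklore] -/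
theorem mem_range_toPlane_of_euler_eq_zero [CharP F p] (b : MvPolynomial (Fin 2) F) (hb : euler F b = 0) :
    b ∈ (toPlane F p).range := by
  classical
  rw [b.as_sum]
  refine Subring.sum_mem _ fun s hs => monomial_mem_range_toPlane F p ?_ _
  have h := coeff_euler F b s
  rw [hb, MvPolynomial.coeff_zero] at h
  have h2 : ((s 0 : F) - (s 1 : F)) = 0 :=
    (mul_eq_zero.mp h.symm).resolve_right (MvPolynomial.mem_support_iff.mp hs)
  exact (CharP.natCast_eq_natCast F p).mp (sub_eq_zero.mp h2)

/-! ## §4 `A → F[a,b]` is injective: `u`-degree `< p` normal forms and `a`-exponents mod `p` -/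

/-- `(ab)^j` is the monomial `a^j b^j`. [folklore] -/
theorem X_mul_X_pow (j : ℕ) :
    (MvPolynomial.X 0 * MvPolynomial.X 1 : MvPolynomial (Fin 2) F) ^ j =
      MvPolynomial.monomial (Finsupp.single 0 j + Finsupp.single 1 j) 1 := by
  rw [MvPolynomial.X, MvPolynomial.X, MvPolynomial.monomial_mul, MvPolynomial.monomial_pow, one_mul,
    one_pow, smul_add, Finsupp.smul_single, Finsupp.smul_single, smul_eq_mul, mul_one]

/-- For `i ≠ j` below `p`, `p ∤ p·m₀ + i − j`. [folklore] -/
theorem not_dvd_aux {p m₀ i j : ℕ} (hi : i < p) (hj : j < p) (hij : j ≠ i) (hle : j ≤ p * m₀ + i) :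
    ¬ p ∣ p * m₀ + i - j := by
  rintro ⟨k, hk⟩
  have h1 : i + p * m₀ = j + p * k := by omega
  have h2 := congrArg (· % p) h1
  simp only [Nat.add_mul_mod_self_left, Nat.mod_eq_of_lt hi, Nat.mod_eq_of_lt hj] at h2
  exact hij h2.symm

/-- **Coefficient extraction**: for a representative `H = Σ_{i<p} cᵢ Uⁱ` of `u`-degree `< p`, the
coefficient of `a^{p m₀ + i} b^{p m₁ + i}` in `toPlane H = Σ cᵢ(a^p,b^p)(ab)ⁱ` is the coefficient of
`y^{m₀} z^{m₁}` in `cᵢ` (the other summands `j ≠ i` only carry `a`-exponents `≡ j (mod p)`). [folklore] -/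
theorem coeff_toPlane_mk [hp : Fact p.Prime] (H : (MvPolynomial (Fin 2) F)[X]) (hH : H.natDegree < p)
    {i : ℕ} (hi : i < p) (m : Fin 2 →₀ ℕ) :
    MvPolynomial.coeff (p • m + (Finsupp.single 0 i + Finsupp.single 1 i)) (toPlane F p (AdjoinRoot.mk _ H)) =
      MvPolynomial.coeff m (H.coeff i) := by
  classical
  rw [toPlane_mk, Polynomial.eval₂_eq_sum_range' _ hH, MvPolynomial.coeff_sum]
  simp only [AlgHom.toRingHom_eq_coe, RingHom.coe_coe, X_mul_X_pow, MvPolynomial.coeff_mul_monomial',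
    mul_one]
  rw [Finset.sum_eq_single i]
  · rw [if_pos le_add_self, add_tsub_cancel_right, MvPolynomial.coeff_expand_smul _ hp.out.ne_zero]
  · intro j hj hji
    split_ifs with hle
    · apply MvPolynomial.coeff_expand_of_not_dvd (i := 0)
      have hle0 := hle 0
      simp only [Finsupp.coe_add, Finsupp.coe_smul, Pi.add_apply, Pi.smul_apply, Finsupp.single_apply,
        if_neg (show (1 : Fin 2) ≠ 0 by decide), add_zero, smul_eq_mul, Finsupp.coe_tsub,
        Pi.sub_apply] at hle0 ⊢
      exact not_dvd_aux hi (Finset.mem_range.mp hj) hji hle0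
    · rfl
  · intro h; exact absurd (Finset.mem_range.mpr hi) h

/-- **`A → F[a,b]` is injective.** A class `w` has a representative `H` of `u`-degree `< p`
(`AdjoinRoot.modByMonicHom`); if `toPlane w = 0` then every coefficient of every `cᵢ` vanishes
(`coeff_toPlane_mk`), so `H = 0`. [folklore] -/
theorem toPlane_injective [hp : Fact p.Prime] : Function.Injective (toPlane F p) := by
  rw [injective_iff_map_eq_zero]
  intro w hw
  have hg : (gPolyAp F p).Monic := monic_gPolyAp F p hp.out.ne_zero
  have hg1 : gPolyAp F p ≠ 1 := by
    intro h; have := congrArg natDegree h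
    rw [natDegree_gPolyAp, natDegree_one] at this; exact hp.out.ne_zero this
  induction w using AdjoinRoot.induction_on with
  | ih H₀ =>
    set H := H₀ %ₘ gPolyAp F p with hHdef
    have hmk : AdjoinRoot.mk (gPolyAp F p) H = AdjoinRoot.mk _ H₀ := by
      rw [hHdef, ← AdjoinRoot.modByMonicHom_mk hg H₀]; exact AdjoinRoot.mk_leftInverse hg _
    have hdeg : H.natDegree < p := by
      rw [← natDegree_gPolyAp F p]; exact natDegree_modByMonic_lt H₀ hg hg1
    rw [← hmk] at hw ⊢
    suffices hH0 : H = 0 by rw [hH0, map_zero]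
    ext i m
    rw [Polynomial.coeff_zero, MvPolynomial.coeff_zero]
    by_cases hi : i < p
    · rw [← coeff_toPlane_mk F p H hdeg hi m, hw, MvPolynomial.coeff_zero]
    · rw [Polynomial.coeff_eq_zero_of_natDegree_lt (lt_of_lt_of_le hdeg (not_lt.mp hi)),
        MvPolynomial.coeff_zero]

end ApRing

end Summit.ResolutionOfSingularities.ResolutionOfSingularities.Theorems.CampaignW82.TwistNormal

end
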